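import Summits.QuantumFields.YangMills.Theorems.BalabanUVNodesN19ContinuumProjectiveFamily

/-!
# YM-DAG node N19 (= NE7 proper) — THE CONTINUUM LAW OF THE WHOLE STRING FIELD: ONE law on `ℝ^{List O}`, the projective limit, by compactness

Cell `pub-ymgap`, HUMAN RULING D-0062 (Track A), R141 (C) wider-strategy seat `pub-ymgap-dag-n19-e` (strategy s3 = ALTERNATIVE CURRENCY), generation
g19, module 1 (lineage module 53).  Route `Summits/QuantumFields/YangMills/Theses/BalabanUVNodes.lean` rev 25, cluster item K3⁷ «SpineGivenEndpointR13SepCoPH»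
(stmt-QuantumFields-20544, dag-lead WORDS-143); filed `--supports` that item `--as helper` (it proves no registered stub).  COUNT-NEUTRAL: [folklore]
measure theory over Mathlib (Tychonoff; Stone–Weierstrass `ContinuousMap.exists_mem_subalgebra_near_continuous_of_isCompact_of_separatesPoints`; Riesz–Markov–Kakutani
`RealRMK.rieszMeasure` on the compact metrizable cube `[−B,B]^ι`, `ι` COUNTABLE; `MeasureTheory.IsProjectiveLimit`) + the seat's p558060 `…N19ContinuumJointLaws`
(`vec_mem_cube`, `aeval_coord_apply`, `coordSubalgebra_separatesPoints`, `jointLawLimit_unique`, `prodObs_flatten`) and p560179 `…N19ContinuumProjectiveFamily`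
(`exists_projectiveFamily_of_hasContinuumLimit`) BY NAME; `Missing.HasContinuumLimit` ∕ `T4ApexVariance.StringwiseMatching` are HYPOTHESES; no Theses import.

THE POINT.  p558060 ∕ p560179 read the programme's endpoint `HasContinuumLimit S` at law level as a PROJECTIVE FAMILY of continuum finite-dimensional
distributions of the string field `(∏os)_{os ∈ List O}` and left the existence of its projective limit — ONE law on `ℝ^{List O}` — to «the Kolmogorov
extension theorem, NOT in Mathlib at this snapshot and NOT claimed».  In THIS setting no Kolmogorov theorem is needed: every coordinate is `[−1,1]`-valued,
so the string field lives in the cube `[−1,1]^{List O}`, which is COMPACT (Tychonoff) and — for countably many strings, `[Countable O]` — metrizable with Borel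
σ-algebra = product σ-algebra.  The cylinder polynomials (polynomials in finitely many coordinates) separate points, so they are dense in `C([−1,1]^{List O})`
(Stone–Weierstrass); a cylinder MONOMIAL `∏_{os} (∏os)^{k_os}` (`k` finitely supported) is the observable of ONE concatenated string, so under
`HasContinuumLimit` its expectation converges; hence (Cauchy, §1) `∫ F((∏os)_{os}) dgibbs_K` converges for EVERY continuous `F` on `ℝ^{List O}`, and
Riesz–Markov–Kakutani names the limit: ★★ `exists_stringFieldLaw_of_hasContinuumLimit` — a unique probability law `ν` on `ℝ^{List O}`, carried by the cube,
the weak limit of the law of the whole string field under `gibbs_K` (★ `tendsto_law_stringField_of_stringFieldLaw`).  Its finite-dimensional marginals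
receive the joint-law limits, so ★★ `isProjectiveLimit_stringFieldLaw`: `ν` IS the projective limit (`MeasureTheory.IsProjectiveLimit`) of ANY family
`J ↦ P_J` receiving them — in particular of p560179's family: ★★ `exists_projectiveLimit_of_hasContinuumLimit` (the Kolmogorov CONCLUSION holds here, by
compactness).  The continuum string expectations are `ν`'s coordinate means (★ `tendsto_expectAt_integral_coord`), and ★ `hasContinuumLimit_iff_stringFieldLaw`:
`HasContinuumLimit S` ⇔ the law of the string field converges weakly to some probability law on `ℝ^{List O}`.  So, read at law level, the endpoint of the
finite-torus programme is exactly ONE stochastic process on the fixed torus indexed by strings.  §1 is the generic countable-index edition of p558060 §1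
(observables `|X K i| ≤ B`, `i ∈ ι` countable, all finitely supported mixed moments `∫ ∏_i (X K i)^{k i} dμ_K`, `k : ι →₀ ℕ`, converge).

HONEST FRAMING (binding).  [folklore]; NO consumer in the DAG today.  `HasContinuumLimit` ∕ `StringwiseMatching` are HYPOTHESES (the cell's located,
unprinted estimates U1–U5 stand between Bałaban's papers and them); nothing of Bałaban's is instantiated; N19 NOT discharged; count-neutral.  The law `ν`
is a typed RESTATEMENT DEVICE for the string-indexed limits (dag-lead guard): it packages `HasContinuumLimit`, proves nothing about it.  One finite `T⁴`
programme at fixed `ε` → 0 at FIXED volume; NOT a continuum ∕ `ℝ⁴` ∕ infinite-volume ∕ OS ∕ mass-gap ∕ Clay statement.  0 `def` ∕ 0 `sorry`.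
-/

noncomputable section

open Set Filter Topology MeasureTheory ProbabilityTheory
open scoped CompactlySupported

namespace Summit.QuantumFields.YangMills.Theorems.BalabanUVNodesN19ContinuumStringFieldLaw

open Literature.MathematicalPhysics.QuantumFieldTheory.Balaban1983to89
open Summit.QuantumFields.YangMills.Theorems.BalabanUVNodesN19ContinuumJointLaws
  (vec_mem_cube aeval_coord_apply coordSubalgebra_separatesPoints jointLawLimit_unique)

/-! ## §1 Generic [folklore]: countably many bounded observables whose finitely supported mixed moments converge have a unique process law on the cube -/

section Generic

variable {ι : Type*}

/-- Finitely supported monomials: multiplying by one more coordinate adds `Finsupp.single n 1` to the exponent. [bookkeeping] -/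
theorem finsuppProd_pow_add_single (k : ι →₀ ℕ) (n : ι) (x : ι → ℝ) :
    (k + Finsupp.single n 1).prod (fun i e => x i ^ e) = k.prod (fun i e => x i ^ e) * x n := by
  classical
  rw [Finsupp.prod_add_index' (h_zero := fun i => pow_zero (x i)) (h_add := fun i a b => pow_add (x i) a b),
    Finsupp.prod_single_index (a := n) (b := 1) (h := fun i e => x i ^ e) (pow_zero _), pow_one]

/-- A finitely supported monomial is a continuous function on `ι → ℝ`. [bookkeeping] -/
theorem continuous_finsuppProd_pow (k : ι →₀ ℕ) : Continuous fun x : ι → ℝ => k.prod (fun i e => x i ^ e) :=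
  continuous_finsetProd _ fun i _ => (continuous_apply i).pow _

variable {Ω : ℕ → Type*} [∀ K, MeasurableSpace (Ω K)] {μ : ∀ K, Measure (Ω K)} {X : ∀ K, ι → Ω K → ℝ} {B : ℝ}

/-- The process `ω ↦ (X K i ω)_i` is a.e.-measurable (countable index). [folklore] -/
theorem aemeasurable_vec_countable [Countable ι] (hX : ∀ K i, AEMeasurable (X K i) (μ K)) (K : ℕ) :
    AEMeasurable (fun ω => fun i => X K i ω) (μ K) :=
  aemeasurable_pi_lambda _ fun i => hX K i

/-- A continuous function of the process is integrable (bounded on the compact cube — Tychonoff). [folklore] -/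
theorem integrable_comp_vec_countable [∀ K, IsProbabilityMeasure (μ K)] [Countable ι] (hX : ∀ K i, AEMeasurable (X K i) (μ K))
    (hB : ∀ K i ω, |X K i ω| ≤ B) {f : (ι → ℝ) → ℝ} (hf : Continuous f) (K : ℕ) : Integrable (fun ω => f (fun i => X K i ω)) (μ K) := by
  obtain ⟨C, hC⟩ := (isCompact_univ_pi fun _ : ι => (isCompact_Icc : IsCompact (Icc (-B) B))).exists_bound_of_continuousOn hf.continuousOn
  exact (integrable_const C).mono' (hf.comp_aestronglyMeasurable (aemeasurable_vec_countable hX K).aestronglyMeasurable)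
    (ae_of_all _ fun ω => hC _ (vec_mem_cube hB K ω))

/-- **CYLINDER POLYNOMIALS CONVERGE**: if every finitely supported mixed moment `∫ ∏_i (X K i)^{k i} dμ_K` (`k : ι →₀ ℕ`) converges, so does
`∫ p(X K) dμ_K` for every real polynomial `p` in the (possibly infinitely many) variables `ι` (induction on `p`, carrying a monomial multiplier). [folklore] -/
theorem tendsto_integral_mvPolynomial_of_tendsto_finsuppMoments [∀ K, IsProbabilityMeasure (μ K)] [Countable ι]
    (hX : ∀ K i, AEMeasurable (X K i) (μ K)) (hB : ∀ K i ω, |X K i ω| ≤ B)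
    (hmom : ∀ k : ι →₀ ℕ, ∃ a : ℝ, Tendsto (fun K => ∫ ω, k.prod (fun i e => X K i ω ^ e) ∂μ K) atTop (𝓝 a)) (p : MvPolynomial ι ℝ) :
    ∃ a : ℝ, Tendsto (fun K => ∫ ω, MvPolynomial.eval (fun i => X K i ω) p ∂μ K) atTop (𝓝 a) := by
  suffices h : ∀ k : ι →₀ ℕ, ∃ a : ℝ,
      Tendsto (fun K => ∫ ω, MvPolynomial.eval (fun i => X K i ω) p * k.prod (fun i e => X K i ω ^ e) ∂μ K) atTop (𝓝 a) by
    obtain ⟨a, ha⟩ := h 0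
    exact ⟨a, ha.congr fun K => by simp⟩
  induction p using MvPolynomial.induction_on with
  | C a =>
    intro k
    obtain ⟨b, hb⟩ := hmom k
    refine ⟨a * b, (hb.const_mul a).congr fun K => ?_⟩
    simp only [MvPolynomial.eval_C]
    exact (integral_const_mul a _).symm
  | add p q hp hq =>
    intro k
    obtain ⟨a, ha⟩ := hp k
    obtain ⟨b, hb⟩ := hq k
    refine ⟨a + b, (ha.add hb).congr fun K => ?_⟩
    have hIp := integrable_comp_vec_countable hX hB (f := fun v => MvPolynomial.eval v p * k.prod (fun i e => v i ^ e))
      ((MvPolynomial.continuous_eval p).mul (continuous_finsuppProd_pow k)) K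
    have hIq := integrable_comp_vec_countable hX hB (f := fun v => MvPolynomial.eval v q * k.prod (fun i e => v i ^ e))
      ((MvPolynomial.continuous_eval q).mul (continuous_finsuppProd_pow k)) K
    rw [← integral_add hIp hIq]
    refine integral_congr_ae (ae_of_all _ fun ω => ?_)
    simp only [map_add]
    ring
  | mul_X p n hp =>
    intro k
    obtain ⟨a, ha⟩ := hp (k + Finsupp.single n 1)
    refine ⟨a, ha.congr fun K => integral_congr_ae (ae_of_all _ fun ω => ?_)⟩
    simp only [MvPolynomial.eval_X, map_mul, finsuppProd_pow_add_single]
    ring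

/-- ★ **EVERY CONTINUOUS FUNCTIONAL OF THE PROCESS `X_K` CONVERGES** [folklore]: observables `|X K i| ≤ B`, `i ∈ ι` countable, all of whose finitely
supported mixed moments converge ⇒ `∫ F(X K) dμ_K` converges for EVERY continuous `F : (ι → ℝ) → ℝ` — Stone–Weierstrass on the COMPACT cube `[−B,B]^ι`
(Tychonoff; the cylinder-polynomial subalgebra separates points, p558060 `coordSubalgebra_separatesPoints`) and the Cauchy criterion. -/
theorem tendsto_integral_comp_of_tendsto_finsuppMoments [∀ K, IsProbabilityMeasure (μ K)] [Countable ι]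
    (hX : ∀ K i, AEMeasurable (X K i) (μ K)) (hB : ∀ K i ω, |X K i ω| ≤ B)
    (hmom : ∀ k : ι →₀ ℕ, ∃ a : ℝ, Tendsto (fun K => ∫ ω, k.prod (fun i e => X K i ω ^ e) ∂μ K) atTop (𝓝 a)) {f : (ι → ℝ) → ℝ} (hf : Continuous f) :
    ∃ a : ℝ, Tendsto (fun K => ∫ ω, f (fun i => X K i ω) ∂μ K) atTop (𝓝 a) := by
  refine cauchySeq_tendsto_of_complete (Metric.cauchySeq_iff'.2 fun ε hε => ?_)
  obtain ⟨g, hgA, hg⟩ := ContinuousMap.exists_mem_subalgebra_near_continuous_of_isCompact_of_separatesPoints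
    (coordSubalgebra_separatesPoints (ι := ι)) ⟨f, hf⟩
    (isCompact_univ_pi fun _ : ι => (isCompact_Icc : IsCompact (Icc (-B) B))) (ε := ε / 3) (by positivity)
  obtain ⟨p, rfl⟩ := (AlgHom.mem_range _).1 hgA
  obtain ⟨a, ha⟩ := tendsto_integral_mvPolynomial_of_tendsto_finsuppMoments hX hB hmom p
  obtain ⟨N, hN⟩ := Metric.cauchySeq_iff'.1 ha.cauchySeq (ε / 3) (by positivity)
  have hclose : ∀ K, dist (∫ ω, f (fun i => X K i ω) ∂μ K) (∫ ω, MvPolynomial.eval (fun i => X K i ω) p ∂μ K) ≤ ε / 3 := fun K => by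
    rw [dist_eq_norm, ← integral_sub (integrable_comp_vec_countable hX hB hf K)
      (integrable_comp_vec_countable hX hB (MvPolynomial.continuous_eval p) K)]
    refine (norm_integral_le_of_norm_le_const (C := ε / 3) (Eventually.of_forall fun ω => ?_)).trans
      (by rw [probReal_univ, mul_one])
    have h := hg _ (vec_mem_cube hB K ω)
    rw [aeval_coord_apply] at h
    rw [Real.norm_eq_abs, abs_sub_comm]
    exact (le_of_lt (by simpa [Real.norm_eq_abs] using h))
  refine ⟨N, fun K hK => ?_⟩
  have h₁ := hclose K
  have h₂ := hN K hK
  have h₃ := hclose N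
  rw [dist_comm] at h₃
  calc dist (∫ ω, f (fun i => X K i ω) ∂μ K) (∫ ω, f (fun i => X N i ω) ∂μ N)
      ≤ dist (∫ ω, f (fun i => X K i ω) ∂μ K) (∫ ω, MvPolynomial.eval (fun i => X K i ω) p ∂μ K)
          + dist (∫ ω, MvPolynomial.eval (fun i => X K i ω) p ∂μ K) (∫ ω, MvPolynomial.eval (fun i => X N i ω) p ∂μ N)
          + dist (∫ ω, MvPolynomial.eval (fun i => X N i ω) p ∂μ N) (∫ ω, f (fun i => X N i ω) ∂μ N) := dist_triangle4 _ _ _ _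
    _ < ε := by linarith

/-- ★★ **THE PROCESS LAW** [folklore] (Riesz–Markov–Kakutani on the compact metrizable cube `[−B,B]^ι`, `ι` countable — NO Kolmogorov extension theorem):
probability spaces `μ K`, observables `|X K i| ≤ B` (`0 ≤ B`, a.e.-measurable) ALL OF WHOSE finitely supported MIXED MOMENTS CONVERGE ⇒ a probability measure `ν`
on `ι → ℝ` (Borel = product σ-algebra), carried by `[−B,B]^ι`, with `∫ F(X K) dμ_K → ∫ F dν` for EVERY continuous `F`.  As p558060's finite-index theorem: the
limit functional on `C([−B,B]^ι, ℝ)` (through the retraction `projIcc`) is linear, positive, normalised; `RealRMK.rieszMeasure`, pushed to `ι → ℝ`. -/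
theorem exists_processLaw_of_tendsto_finsuppMoments [∀ K, IsProbabilityMeasure (μ K)] [Countable ι]
    (hX : ∀ K i, AEMeasurable (X K i) (μ K)) (h0 : 0 ≤ B) (hB : ∀ K i ω, |X K i ω| ≤ B)
    (hmom : ∀ k : ι →₀ ℕ, ∃ a : ℝ, Tendsto (fun K => ∫ ω, k.prod (fun i e => X K i ω ^ e) ∂μ K) atTop (𝓝 a)) :
    ∃ ν : Measure (ι → ℝ), IsProbabilityMeasure ν ∧ ν (Set.pi Set.univ (fun _ : ι => Icc (-B) B))ᶜ = 0 ∧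
      ∀ F : (ι → ℝ) → ℝ, Continuous F → Tendsto (fun K => ∫ ω, F (fun i => X K i ω) ∂μ K) atTop (𝓝 (∫ x, F x ∂ν)) := by
  have h0' : -B ≤ B := by linarith
  -- the compact cube as a (countable) product of compact intervals, its embedding and the coordinatewise retraction
  let Q : Type _ := ι → Icc (-B) B
  let emb : Q → (ι → ℝ) := fun y i => (y i : ℝ)
  have hemb : Continuous emb := continuous_pi fun i => continuous_subtype_val.comp (continuous_apply i)
  let ρ : (ι → ℝ) → Q := fun x i => projIcc (-B) B h0' (x i)
  have hρ : Continuous ρ := continuous_pi fun i => continuous_projIcc.comp (continuous_apply i)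
  have hρX : ∀ K ω, emb (ρ (fun i => X K i ω)) = fun i => X K i ω := fun K ω => by
    ext i
    simp only [emb, ρ, projIcc_of_mem h0' (abs_le.1 (hB K i ω))]
  -- the limit functional on `C(Q, ℝ)`
  have hL : ∀ φ : C(Q, ℝ), ∃ a : ℝ, Tendsto (fun K => ∫ ω, φ (ρ (fun i => X K i ω)) ∂μ K) atTop (𝓝 a) :=
    fun φ => tendsto_integral_comp_of_tendsto_finsuppMoments hX hB hmom (f := fun x => φ (ρ x)) (φ.continuous.comp hρ)
  choose L hL using hL
  have hI : ∀ (K) (φ : C(Q, ℝ)), Integrable (fun ω => φ (ρ (fun i => X K i ω))) (μ K) := fun K φ =>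
    integrable_comp_vec_countable hX hB (f := fun x => φ (ρ x)) (φ.continuous.comp hρ) K
  have hadd : ∀ φ ψ : C(Q, ℝ), L (φ + ψ) = L φ + L ψ := fun φ ψ =>
    tendsto_nhds_unique (hL (φ + ψ)) (((hL φ).add (hL ψ)).congr fun K => by
      simp only [ContinuousMap.add_apply]
      exact (integral_add (hI K φ) (hI K ψ)).symm)
  have hsmul : ∀ (c : ℝ) (φ : C(Q, ℝ)), L (c • φ) = c * L φ := fun c φ =>
    tendsto_nhds_unique (hL (c • φ)) (((hL φ).const_mul c).congr fun K => by
      simp only [ContinuousMap.smul_apply, smul_eq_mul]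
      exact (integral_const_mul c _).symm)
  have hpos : ∀ φ : C(Q, ℝ), (∀ y, 0 ≤ φ y) → 0 ≤ L φ := fun φ hφ =>
    ge_of_tendsto' (hL φ) fun K => integral_nonneg fun ω => hφ _
  have hone : L 1 = 1 := tendsto_nhds_unique (hL 1) (tendsto_const_nhds.congr fun K => by simp)
  -- Riesz–Markov–Kakutani on the compact cube
  let Λₗ : C_c(Q, ℝ) →ₗ[ℝ] ℝ :=
    { toFun := fun f => L f.toContinuousMap
      map_add' := fun f g => by
        have : (f + g).toContinuousMap = f.toContinuousMap + g.toContinuousMap := by ext; rfl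
        rw [this, hadd]
      map_smul' := fun c f => by
        have : (c • f).toContinuousMap = c • f.toContinuousMap := by ext; rfl
        rw [this, hsmul]
        rfl }
  let Λp : C_c(Q, ℝ) →ₚ[ℝ] ℝ := PositiveLinearMap.mk₀ Λₗ fun f hf => hpos f.toContinuousMap fun y => hf y
  have hΛp : ∀ f, Λp f = L f.toContinuousMap := fun _ => rfl
  let ν₀ : Measure Q := RealRMK.rieszMeasure Λp
  have hν₀ : ∀ φ : C(Q, ℝ), ∫ y, φ y ∂ν₀ = L φ := fun φ => by
    have h := RealRMK.integral_rieszMeasure Λp ⟨φ, HasCompactSupport.of_compactSpace φ⟩; rw [hΛp] at h; exact h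
  haveI : IsProbabilityMeasure ν₀ := by
    constructor
    have h1 : ∫ y, (1 : C(Q, ℝ)) y ∂ν₀ = 1 := (hν₀ 1).trans hone
    simp only [ContinuousMap.one_apply, integral_const, smul_eq_mul, mul_one] at h1
    rwa [measureReal_def, ENNReal.toReal_eq_one_iff] at h1
  have hpre : emb ⁻¹' (Set.pi Set.univ (fun _ : ι => Icc (-B) B))ᶜ = ∅ := by
    ext y
    simp only [mem_preimage, mem_compl_iff, mem_empty_iff_false, iff_false, not_not, Set.mem_univ_pi]
    exact fun i => (y i).2
  refine ⟨ν₀.map emb, Measure.isProbabilityMeasure_map hemb.measurable.aemeasurable, ?_, fun F hF => ?_⟩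
  · rw [Measure.map_apply hemb.measurable (MeasurableSet.univ_pi fun _ => measurableSet_Icc).compl, hpre, measure_empty]
  · rw [integral_map hemb.measurable.aemeasurable hF.aestronglyMeasurable]
    have h := hL ⟨fun y => F (emb y), hF.comp hemb⟩
    rw [← hν₀] at h
    refine h.congr fun K => integral_congr_ae (Eventually.of_forall fun ω => ?_)
    simp only [ContinuousMap.coe_mk, hρX K ω]

/-- **THE PROCESS LAW IS UNIQUE**: two probability measures on `ι → ℝ` (`ι` countable) receiving the limits of all continuous functionals coincide (Mathlib
`ext_of_forall_integral_eq_of_IsFiniteMeasure` on the Polish space `ι → ℝ`). [folklore] -/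
theorem processLaw_unique [Countable ι] (ν₁ ν₂ : Measure (ι → ℝ)) [IsProbabilityMeasure ν₁] [IsProbabilityMeasure ν₂]
    (h₁ : ∀ F : (ι → ℝ) → ℝ, Continuous F → Tendsto (fun K => ∫ ω, F (fun i => X K i ω) ∂μ K) atTop (𝓝 (∫ x, F x ∂ν₁)))
    (h₂ : ∀ F : (ι → ℝ) → ℝ, Continuous F → Tendsto (fun K => ∫ ω, F (fun i => X K i ω) ∂μ K) atTop (𝓝 (∫ x, F x ∂ν₂))) :
    ν₁ = ν₂ :=
  ext_of_forall_integral_eq_of_IsFiniteMeasure fun F => tendsto_nhds_unique (h₁ F F.continuous) (h₂ F F.continuous)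

/-- **WEAK CONVERGENCE OF THE LAW OF THE PROCESS** in Mathlib's words: `(μ K).map (X K) → ν` in `ProbabilityMeasure (ι → ℝ)`. [folklore] -/
theorem tendsto_law_of_processLaw [∀ K, IsProbabilityMeasure (μ K)] [Countable ι]
    (hX : ∀ K i, AEMeasurable (X K i) (μ K)) (ν : ProbabilityMeasure (ι → ℝ))
    (hν : ∀ F : (ι → ℝ) → ℝ, Continuous F →
      Tendsto (fun K => ∫ ω, F (fun i => X K i ω) ∂μ K) atTop (𝓝 (∫ x, F x ∂(ν : Measure (ι → ℝ))))) :
    Tendsto (β := ProbabilityMeasure (ι → ℝ))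
      (fun K => ⟨(μ K).map (fun ω => fun i => X K i ω), Measure.isProbabilityMeasure_map (aemeasurable_vec_countable hX K)⟩) atTop (𝓝 ν) := by
  refine ProbabilityMeasure.tendsto_iff_forall_integral_tendsto.2 fun F => ?_
  exact (hν F F.continuous).congr fun K => (integral_map (aemeasurable_vec_countable hX K) F.continuous.aestronglyMeasurable).symm

/-- ★ **THE PROCESS LAW IS THE PROJECTIVE LIMIT OF ITS FINITE-DIMENSIONAL LIMITS** [folklore]: if `ν` receives the limits of all continuous functionals of
the process and, for every finite `J ⊆ ι`, a probability law `P_J` on `ℝ^J` receives the limits of all continuous functionals of the sub-family `(X K j)_{j∈J}`,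
then `ν.map J.restrict = P_J` for every `J` (`MeasureTheory.IsProjectiveLimit ν P`) — the pushed-forward law also receives them (`f ∘ J.restrict` is
continuous) and the finite-dimensional weak limit is unique (p558060 `jointLawLimit_unique`). -/
theorem isProjectiveLimit_processLaw [Countable ι] (ν : Measure (ι → ℝ)) [IsProbabilityMeasure ν]
    (hν : ∀ F : (ι → ℝ) → ℝ, Continuous F → Tendsto (fun K => ∫ ω, F (fun i => X K i ω) ∂μ K) atTop (𝓝 (∫ x, F x ∂ν)))
    (P : ∀ J : Finset ι, Measure (↥J → ℝ)) [∀ J, IsProbabilityMeasure (P J)]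
    (hP : ∀ (J : Finset ι) (f : (↥J → ℝ) → ℝ), Continuous f →
      Tendsto (fun K => ∫ ω, f (fun j : ↥J => X K j.1 ω) ∂μ K) atTop (𝓝 (∫ x, f x ∂P J))) :
    IsProjectiveLimit (α := fun _ : ι => ℝ) ν P := by
  intro J
  have hr : Continuous (J.restrict (π := fun _ : ι => ℝ)) := by fun_prop
  haveI : IsProbabilityMeasure (ν.map (J.restrict (π := fun _ : ι => ℝ))) := Measure.isProbabilityMeasure_map hr.measurable.aemeasurable
  refine jointLawLimit_unique (μ := μ) (X := fun K (j : ↥J) ω => X K j.1 ω) _ (P J) (fun f hf => ?_) (hP J)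
  rw [integral_map hr.measurable.aemeasurable hf.aestronglyMeasurable]
  exact hν (fun x => f (J.restrict (π := fun _ : ι => ℝ) x)) (hf.comp hr)

end Generic

/-! ## §2 At the scheme: `HasContinuumLimit` ⇒ the continuum law of the WHOLE string field (countably many strings) and its projective-limit property -/

section Scheme

open T4GenFunBounds (prodObs gibbsMeasure expectAt_eq_integral_gibbs)
open Missing (TorusScheme HasContinuumLimit)
open Summit.QuantumFields.YangMills.Theorems.BalabanUVNodesN19ContinuumJointLaws (prodObs_flatten prodObs_replicate_flatten)
open Summit.QuantumFields.YangMills.Theorems.BalabanUVNodesN19ContinuumProjectiveFamily (exists_projectiveFamily_of_hasContinuumLimit)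

variable {G : Type*} [GaugeGroup G] [MeasurableSpace G] [RegularGaugeGroup G] [HaarData G] {O : Type*}
  (S : TorusScheme G O) (hβ : ∀ K, 0 ≤ S.β K) (hm : ∀ K o, Measurable (S.obs K o))
  (h1 : ∀ K o U, |S.obs K o U| ≤ 1)

omit [GaugeGroup G] [MeasurableSpace G] [RegularGaugeGroup G] [HaarData G] in
/-- **A CYLINDER MONOMIAL OF THE STRING FIELD IS A STRING OBSERVABLE**: for a finitely supported exponent `k : List O →₀ ℕ`,
`∏_{os} (∏os)^{k os} = ∏(the concatenation, over the support of `k`, of `k os` copies of `os`)`. [bookkeeping] -/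
theorem prodObs_finsuppString (K : ℕ) (k : List O →₀ ℕ) (U : GaugeField (S.P K) 0 G) :
    prodObs S K ((k.support.toList.map fun os => (List.replicate (k os) os).flatten).flatten) U =
      k.prod fun os e => prodObs S K os U ^ e := by
  rw [prodObs_flatten, List.map_map, Finsupp.prod, ← Finset.prod_map_toList]
  congr 1
  refine List.map_congr_left fun os _ => ?_
  simp only [Function.comp_apply, prodObs_replicate_flatten]

include hβ hm h1

omit hm h1 in
/-- **★ CYLINDER MOMENTS CONVERGE UNDER `HasContinuumLimit`**: for every finitely supported exponent `k : List O →₀ ℕ`,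
`∫ ∏_{os} (∏os)^{k os} dgibbs_K` converges (it is `S.expectAt K` of one concatenated string). [bookkeeping] -/
theorem tendsto_finsuppMoment_of_hasContinuumLimit (hC : HasContinuumLimit S) (k : List O →₀ ℕ) :
    ∃ a : ℝ, Tendsto (fun K => ∫ U, k.prod (fun os e => prodObs S K os U ^ e) ∂gibbsMeasure (S.P K) (S.β K)) atTop (𝓝 a) := by
  obtain ⟨l, hl⟩ := hC ((k.support.toList.map fun os => (List.replicate (k os) os).flatten).flatten)
  refine ⟨l, hl.congr fun K => ?_⟩
  rw [expectAt_eq_integral_gibbs S hβ K]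
  exact integral_congr_ae (ae_of_all _ fun U => prodObs_finsuppString S K k U)

/-- **★★ THE CONTINUUM LAW OF THE WHOLE STRING FIELD FROM `HasContinuumLimit`.**  For a torus scheme with `β_K ≥ 0`, measurable observables bounded by `1`
and countably many observable labels (`[Countable O]`), IF all string expectations converge (`Missing.HasContinuumLimit S` — a HYPOTHESIS; Jaffe–Witten's
«limits of appropriate expectations» as the tree types it), THEN there is a unique probability law `ν` on `ℝ^{List O}` (Borel = product σ-algebra), carried by
the cube `[−1,1]^{List O}`, with `∫ F((∏os)_{os}) dgibbs_K → ∫ F dν` for EVERY continuous `F : (List O → ℝ) → ℝ` — the law of the whole string field under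
`gibbs_K` converges weakly to `ν`.  No Kolmogorov extension theorem: Tychonoff + Stone–Weierstrass + Riesz–Markov–Kakutani (§1). [folklore] -/
theorem exists_stringFieldLaw_of_hasContinuumLimit [Countable O] (hC : HasContinuumLimit S) :
    ∃ ν : Measure (List O → ℝ), IsProbabilityMeasure ν ∧ ν (Set.pi Set.univ (fun _ : List O => Icc (-1) 1))ᶜ = 0 ∧
      (∀ F : (List O → ℝ) → ℝ, Continuous F →
        Tendsto (fun K => ∫ U, F (fun os => prodObs S K os U) ∂gibbsMeasure (S.P K) (S.β K)) atTop (𝓝 (∫ x, F x ∂ν))) ∧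
      ∀ ν' : Measure (List O → ℝ), IsProbabilityMeasure ν' →
        (∀ F : (List O → ℝ) → ℝ, Continuous F →
          Tendsto (fun K => ∫ U, F (fun os => prodObs S K os U) ∂gibbsMeasure (S.P K) (S.β K)) atTop (𝓝 (∫ x, F x ∂ν'))) → ν' = ν := by
  haveI : ∀ K, IsProbabilityMeasure (gibbsMeasure (G := G) (S.P K) (S.β K)) := fun K => T4GenFunBounds.isProbabilityMeasure_gibbsMeasure _ (hβ K)
  have hX : ∀ K (os : List O), AEMeasurable (fun U => prodObs S K os U) (gibbsMeasure (S.P K) (S.β K)) := fun K os =>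
    (T4GenFunBounds.measurable_prodObs S hm K os).aemeasurable
  have hB : ∀ K (os : List O) U, |prodObs S K os U| ≤ 1 := fun K os U => T4GenFunBounds.abs_prodObs_le_one S h1 K os U
  obtain ⟨ν, iν, hν1, hν⟩ := exists_processLaw_of_tendsto_finsuppMoments (μ := fun K => gibbsMeasure (S.P K) (S.β K))
    (X := fun K os U => prodObs S K os U) hX zero_le_one hB (fun k => tendsto_finsuppMoment_of_hasContinuumLimit S hβ hC k)
  exact ⟨ν, iν, hν1, hν, fun ν' iν' hν' => processLaw_unique (μ := fun K => gibbsMeasure (S.P K) (S.β K))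
    (X := fun K os U => prodObs S K os U) ν' ν hν' hν⟩

omit [RegularGaugeGroup G] hβ h1 in
/-- **★ WEAK CONVERGENCE OF THE LAW OF THE STRING FIELD** in Mathlib's words: if `ν` receives the limits of all continuous functionals of the string field, then
`gibbs_K.map ((∏os)_{os}) → ν` in `ProbabilityMeasure (List O → ℝ)`. [folklore] -/
theorem tendsto_law_stringField_of_stringFieldLaw [Countable O] (hP : ∀ K, IsProbabilityMeasure (gibbsMeasure (G := G) (S.P K) (S.β K)))
    (ν : ProbabilityMeasure (List O → ℝ))
    (hν : ∀ F : (List O → ℝ) → ℝ, Continuous F →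
      Tendsto (fun K => ∫ U, F (fun os => prodObs S K os U) ∂gibbsMeasure (S.P K) (S.β K)) atTop (𝓝 (∫ x, F x ∂(ν : Measure (List O → ℝ))))) :
    Tendsto (β := ProbabilityMeasure (List O → ℝ))
      (fun K => ⟨(gibbsMeasure (S.P K) (S.β K)).map (fun U => fun os => prodObs S K os U),
        Measure.isProbabilityMeasure_map (aemeasurable_pi_lambda _ fun os => (T4GenFunBounds.measurable_prodObs S hm K os).aemeasurable)⟩)
      atTop (𝓝 ν) :=
  tendsto_law_of_processLaw (μ := fun K => gibbsMeasure (S.P K) (S.β K)) (X := fun K os U => prodObs S K os U)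
    (fun K os => (T4GenFunBounds.measurable_prodObs S hm K os).aemeasurable) ν hν

omit [RegularGaugeGroup G] hβ hm h1 in
/-- **★★ THE STRING-FIELD LAW IS THE PROJECTIVE LIMIT OF THE CONTINUUM JOINT LAWS.**  If `ν` receives the limits of all continuous functionals of the string
field and `J ↦ P_J` (`J : Finset (List O)`) is ANY assignment of probability laws receiving the joint-law limits of `(∏os)_{os∈J}` (p558060 ∕ p560179), then
`ν.map J.restrict = P_J` for every `J`: `MeasureTheory.IsProjectiveLimit ν P`.  (§1 `isProjectiveLimit_processLaw`.) [folklore] -/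
theorem isProjectiveLimit_stringFieldLaw [Countable O] (ν : Measure (List O → ℝ)) [IsProbabilityMeasure ν]
    (hν : ∀ F : (List O → ℝ) → ℝ, Continuous F →
      Tendsto (fun K => ∫ U, F (fun os => prodObs S K os U) ∂gibbsMeasure (S.P K) (S.β K)) atTop (𝓝 (∫ x, F x ∂ν)))
    (P : ∀ J : Finset (List O), Measure (↥J → ℝ)) [∀ J, IsProbabilityMeasure (P J)]
    (hP : ∀ (J : Finset (List O)) (f : (↥J → ℝ) → ℝ), Continuous f →
      Tendsto (fun K => ∫ U, f (fun j : ↥J => prodObs S K j.1 U) ∂gibbsMeasure (S.P K) (S.β K)) atTop (𝓝 (∫ x, f x ∂P J))) :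
    IsProjectiveLimit (α := fun _ : List O => ℝ) ν P :=
  isProjectiveLimit_processLaw (μ := fun K => gibbsMeasure (S.P K) (S.β K)) (X := fun K os U => prodObs S K os U) ν hν P hP

/-- **★★ UNDER `HasContinuumLimit` THE PROJECTIVE FAMILY OF CONTINUUM FINITE-DIMENSIONAL DISTRIBUTIONS HAS A (UNIQUE) PROJECTIVE LIMIT** — the conclusion of the
Kolmogorov extension theorem holds here, by compactness: p560179's family `J ↦ P_J` (receiving the joint-law limits, projective) admits a probability law `ν` on
`ℝ^{List O}` with `IsProjectiveLimit ν P`, unique (Mathlib `IsProjectiveLimit.unique`) — the string-field law (it receives all continuous functionals). [folklore] -/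
theorem exists_projectiveLimit_of_hasContinuumLimit [Countable O] (hC : HasContinuumLimit S) :
    ∃ P : ∀ J : Finset (List O), Measure (↥J → ℝ),
      (∀ J, IsProbabilityMeasure (P J)) ∧
      (∀ J, P J (Set.pi Set.univ (fun _ : ↥J => Icc (-1) 1))ᶜ = 0) ∧
      (∀ (J : Finset (List O)) (f : (↥J → ℝ) → ℝ), Continuous f →
        Tendsto (fun K => ∫ U, f (fun j : ↥J => prodObs S K j.1 U) ∂gibbsMeasure (S.P K) (S.β K)) atTop (𝓝 (∫ x, f x ∂P J))) ∧
      IsProjectiveMeasureFamily (α := fun _ : List O => ℝ) P ∧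
      ∃ ν : Measure (List O → ℝ), IsProbabilityMeasure ν ∧
        (∀ F : (List O → ℝ) → ℝ, Continuous F →
          Tendsto (fun K => ∫ U, F (fun os => prodObs S K os U) ∂gibbsMeasure (S.P K) (S.β K)) atTop (𝓝 (∫ x, F x ∂ν))) ∧
        IsProjectiveLimit (α := fun _ : List O => ℝ) ν P ∧
        ∀ ν' : Measure (List O → ℝ), IsProjectiveLimit (α := fun _ : List O => ℝ) ν' P → ν' = ν := by
  obtain ⟨P, hP1, hPc, hP, hproj⟩ := exists_projectiveFamily_of_hasContinuumLimit S hβ hm h1 hC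
  obtain ⟨ν, iν, -, hν, -⟩ := exists_stringFieldLaw_of_hasContinuumLimit S hβ hm h1 hC
  haveI := hP1
  have hlim : IsProjectiveLimit (α := fun _ : List O => ℝ) ν P := isProjectiveLimit_stringFieldLaw S ν hν P hP
  exact ⟨P, hP1, hPc, hP, hproj, ν, iν, hν, hlim, fun ν' h' => h'.unique hlim⟩

omit hm h1 in
/-- **★ THE CONTINUUM STRING EXPECTATIONS ARE THE COORDINATE MEANS OF THE STRING-FIELD LAW**: if `ν` receives the limits of all continuous functionals of the
string field, then `S.expectAt K os → ∫ x_{os} dν(x)` for every string `os` (the coordinate `x ↦ x os` is continuous; `S.expectAt K os = ∫ ∏os dgibbs_K`). [bookkeeping] -/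
theorem tendsto_expectAt_integral_coord (ν : Measure (List O → ℝ))
    (hν : ∀ F : (List O → ℝ) → ℝ, Continuous F →
      Tendsto (fun K => ∫ U, F (fun os => prodObs S K os U) ∂gibbsMeasure (S.P K) (S.β K)) atTop (𝓝 (∫ x, F x ∂ν)))
    (os : List O) : Tendsto (fun K => S.expectAt K os) atTop (𝓝 (∫ x, x os ∂ν)) := by
  refine (hν (fun x => x os) (continuous_apply os)).congr fun K => ?_
  rw [expectAt_eq_integral_gibbs S hβ K os]

/-- **★ `HasContinuumLimit` ⇔ WEAK CONVERGENCE OF THE LAW OF THE WHOLE STRING FIELD.**  For a torus scheme with `β_K ≥ 0`, measurable observables bounded by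
`1` and countably many observable labels: every string expectation converges IFF the law of the string field `(∏os)_{os}` under `gibbs_K` converges weakly to
some probability law on `ℝ^{List O}` (→ `exists_stringFieldLaw_of_hasContinuumLimit`; ← each coordinate is a continuous functional). [folklore] -/
theorem hasContinuumLimit_iff_stringFieldLaw [Countable O] :
    HasContinuumLimit S ↔
      ∃ ν : Measure (List O → ℝ), IsProbabilityMeasure ν ∧
        ∀ F : (List O → ℝ) → ℝ, Continuous F →
          Tendsto (fun K => ∫ U, F (fun os => prodObs S K os U) ∂gibbsMeasure (S.P K) (S.β K)) atTop (𝓝 (∫ x, F x ∂ν)) := by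
  constructor
  · intro hC
    obtain ⟨ν, iν, -, hν, -⟩ := exists_stringFieldLaw_of_hasContinuumLimit S hβ hm h1 hC
    exact ⟨ν, iν, hν⟩
  · rintro ⟨ν, -, hν⟩ os
    exact ⟨_, tendsto_expectAt_integral_coord S hβ ν hν os⟩

/-- **★ … UNDER NODE U5's PER-STRING OUTPUT** (`T4ApexVariance.StringwiseMatching S` ⇒ `HasContinuumLimit S` by the tree's
`T4ApexVariance.hasContinuumLimit_of_stringwiseMatching`): per-string matching modulo constants with summable remainders already carries the continuum law of
the whole string field. [folklore] -/
theorem exists_stringFieldLaw_of_stringwiseMatching [Countable O] (h : T4ApexVariance.StringwiseMatching S) :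
    ∃ ν : Measure (List O → ℝ), IsProbabilityMeasure ν ∧ ν (Set.pi Set.univ (fun _ : List O => Icc (-1) 1))ᶜ = 0 ∧
      ∀ F : (List O → ℝ) → ℝ, Continuous F →
        Tendsto (fun K => ∫ U, F (fun os => prodObs S K os U) ∂gibbsMeasure (S.P K) (S.β K)) atTop (𝓝 (∫ x, F x ∂ν)) := by
  obtain ⟨ν, iν, hν1, hν, -⟩ := exists_stringFieldLaw_of_hasContinuumLimit S hβ hm h1
    (T4ApexVariance.hasContinuumLimit_of_stringwiseMatching S hβ hm h1 h)
  exact ⟨ν, iν, hν1, hν⟩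

end Scheme

end Summit.QuantumFields.YangMills.Theorems.BalabanUVNodesN19ContinuumStringFieldLaw

end
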